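import Summits.CriticalPhenomena.PercolationContinuityZ3.Theorems.PercNearOneGluingNoHeavyLowerTailCubicFourPointL1ThmCertAll
import Summits.CriticalPhenomena.PercolationContinuityZ3.Theorems.PercNearOneGluingNoHeavyLowerTailCubicFourPointL1ThmCertCells
import Summits.CriticalPhenomena.PercolationContinuityZ3.Theorems.PercNearOneGluingNoHeavyLowerTailFourPointAtoms
import Summits.CriticalPhenomena.PercolationContinuityZ3.Theorems.PercNearOneGluingNoHeavyLowerTailFourPointAtomsStep
import Summits.CriticalPhenomena.PercolationContinuityZ3.Theorems.PercNearOneGluingNoHeavyLowerTailL1CertDict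
import Summits.CriticalPhenomena.PercolationContinuityZ3.Theorems.PercNearOneGluingNoHeavyLowerTailL1CertDictB
import Summits.CriticalPhenomena.PercolationContinuityZ3.Theorems.PercNearOneGluingNoHeavyLowerTailTerminalEdgeStepAllN
import Summits.CriticalPhenomena.PercolationContinuityZ3.Theorems.PercNearOneGluingNoHeavyLowerTailHybridThreePointLB
import Literature.Probability.Percolation.StrongHarrisThreePoint
import Literature.Probability.Percolation.TwoClusterGibbsCovariance
import Literature.Probability.Percolation.KozmaNitzanSeparatingTriple
import HarnessLib

/-!
# `NoHeavyLowerTail` (stmt-CriticalPhenomena-4575) — **(L1) = `PolarisedRowL1` on every finite weighted graph** (and (L2), (B1), (B2))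

Support file (prover prim-cert-2, certificate seat; `--supports stmt-CriticalPhenomena-4575`).  No definitions, no named facts, no sorries,
standard axioms.  The measure-level transfer of the kernel-checked cell theorem `L1ThmCert.polL₁_nonneg_of_rows` (prim-l12-p6's exact
degree-5 certificate over THEOREM rows, `…CubicFourPointL1ThmCert` / `…All`): the fifteen variables are the four-point cells
`FourPointAtoms.cell w a b c y i` of `μ = prodBernoulli w` (prim-bnk-1's dictionary `…FourPointAtoms`, `measureReal_eq_cellSum`), and every
row hypothesis is an instance of a tree theorem moved to cells by the atom decomposition (`decide` on the 15 patterns):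
Aas–Gladkov `prodBernoulli_threePoint_strongHarris` on `(a,b,c), (a,b,y), (a,c,y), (b,c,y)`; 3PT-LB `ThreePointLB.threePointLB_prodBernoulli`
on the same triples; the hybrid/group lower bound `HybridThreePointLB.sahiE3_hybrid_nonneg` in eight instances `(P₁;c′;P₃⊆P₃′)` (incl. `hybE₁`,
`hybE₂`) and `TerminalEdgeStep.hybE₃g_cell_nonneg`; and the two QUOTIENT rows (Aas–Gladkov and 3PT-LB on `({a,y}, b, c)` of `G/{a=y}`),
obtained from the same theorems for the weight `w[s(a,y) ↦ 1]` via `real_update_ay` — gluing `a = y` = pulling back along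
`ω ↦ insert s(a,y) ω` (`BHK2006.prodBernoulli_map_union`) — and `KNSep.reachable_insert_iff` (one extra edge).
RESULTS: `polL₁_cells_nonneg`; **`polarisedRowL1 : PolarisedRowL1`** (the `@[conjecture]` of `…GroupSepHybridRows`, now a theorem);
`polarisedRowL2 : PolarisedRowL2`; `bernsteinPieces : BernsteinPieceB1 ∧ BernsteinPieceB2`; `bernsteinStepUpTo N`, `polarisedStepUpTo N`
for every `N` (prim-bnk-1's bridges `…TerminalEdgeStepOfL1/AllN`).  HONEST SCOPE (lead LEAD-GEN11 §2): these are the stand-alone four-point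
theorems of the SHK3⁺ terminal-edge package (a second, inductive proof of SHK3⁺); they are not on the one-cut |A| = 5 rung.
[this work] (sources: prim-l12-p6 certificate; prim-bnk-1 dictionary; prim-cert-2 kernel replay)
-/

noncomputable section

namespace Summit.CriticalPhenomena.PercolationContinuityZ3.Theorems

namespace L1ThmCert

open MeasureTheory Set Literature.Probability.Percolation
open Literature.Probability.LatticeModels (prodBernoulli sahiE3 sahiE3_def)
open Summit.CriticalPhenomena.PercolationContinuityZ3.Cruxes.AdditiveGluing.TieLine.ConnAtoms
open FourPointAtoms CubicFourPoint ThreePointLB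

variable {V : Type} [Fintype V] [DecidableEq V] (w : Sym2 V → unitInterval) (a b c y : V)

/-! ### Forcing the pair `s(a,y)`: the quotient `a = y` as the weight `w[ay ↦ 1]` -/

/-- **Gluing `a = y` is pulling back along `ω ↦ insert s(a,y) ω`**: for every event `E`,
`P_{w[ay↦1]}(E) = P_w({ω | insert s(a,y) ω ∈ E})` (`BHK2006.integral_comp_union_prodBernoulli`, Kozma–Nitzan's gluing by a weight-one pair). [this work] -/
theorem real_update_ay (E : Set (BondConfig V)) :
    (prodBernoulli (Function.update w s(a, y) 1)).real E = (prodBernoulli w).real ((fun ω : BondConfig V => insert s(a, y) ω) ⁻¹' E) := by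
  classical
  have h := BHK2006.integral_comp_union_prodBernoulli w (Function.update w s(a, y) 1) ({s(a, y)} : Set (Sym2 V))
    (fun i hi => by rw [Set.mem_singleton_iff.mp hi, Function.update_self])
    (fun i hi => by rw [Function.update_of_ne (fun h => hi (Set.mem_singleton_iff.mpr h))]) (E.indicator 1)
  have hpre : (fun η : BondConfig V => E.indicator (1 : BondConfig V → ℝ) (η ∪ {s(a, y)})) =
      ((fun ω : BondConfig V => insert s(a, y) ω) ⁻¹' E).indicator 1 := by
    funext η
    simp only [Set.indicator_apply, Set.mem_preimage, Set.union_singleton, Pi.one_apply]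
  rw [hpre, integral_indicator_one MeasurableSet.of_discrete, integral_indicator_one MeasurableSet.of_discrete] at h
  exact h.symm

omit [Fintype V] [DecidableEq V] in
/-- **One forced pair and four marked points**: `insert s(a,y)` pulls `{x ↔ z}` back to `{x ↔ z} ∪ ({x ↔ a} ∩ {y ↔ z}) ∪ ({x ↔ y} ∩ {a ↔ z})`
(`KNSep.reachable_insert_iff`). [folklore] -/
theorem preimage_insert_openConn (x z : V) :
    (fun ω : BondConfig V => insert s(a, y) ω) ⁻¹' openConn x z =
      openConn x z ∪ (openConn x a ∩ openConn y z) ∪ (openConn x y ∩ openConn a z) := by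
  ext ω
  simp only [Set.mem_preimage, Set.mem_union, Set.mem_inter_iff, openConn, Set.mem_setOf_eq, KNSep.reachable_insert_iff]
  tauto

/-! ### The rows of the certificate at the cells of `prodBernoulli w` -/

omit [DecidableEq V] in
/-- Row `Fabc` at the cells of `prodBernoulli w` — 3PT-LB `threePointLB_prodBernoulli`. -/
theorem row_Fabc : 0 ≤ CubicThreePointStep.F ((cell w a b c y 0) + (cell w a b c y 1) + (cell w a b c y 2) + (cell w a b c y 4)) ((cell w a b c y 6) + (cell w a b c y 11) + (cell w a b c y 12)) ((cell w a b c y 5) + (cell w a b c y 9) + (cell w a b c y 10)) ((cell w a b c y 3) + (cell w a b c y 7) + (cell w a b c y 8)) ((cell w a b c y 13) + (cell w a b c y 14)) := by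
  have h := threePointLB_prodBernoulli w a b c
  rw [FourPointAtoms.real_lt, FourPointAtoms.real_shk_ABC, FourPointAtoms.real_lu1, FourPointAtoms.real_lu2, FourPointAtoms.real_lu3] at h
  have hs : (cell w a b c y 0) + (cell w a b c y 1) + (cell w a b c y 2) + (cell w a b c y 4) + ((cell w a b c y 6) + (cell w a b c y 11) + (cell w a b c y 12)) + ((cell w a b c y 5) + (cell w a b c y 9) + (cell w a b c y 10)) + ((cell w a b c y 3) + (cell w a b c y 7) + (cell w a b c y 8)) + ((cell w a b c y 13) + (cell w a b c y 14)) + ((cell w a b c y 13) + (cell w a b c y 14)) = 1 + ((cell w a b c y 13) + (cell w a b c y 14)) := by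
    have h1 := sum_cell_eq_one w a b c y; linarith
  simp only [CubicThreePointStep.F]
  rw [hs]
  exact h.trans_eq (by ring)

omit [DecidableEq V] in
/-- Row `Faby` at the cells of `prodBernoulli w` — 3PT-LB `threePointLB_prodBernoulli`. -/
theorem row_Faby : 0 ≤ CubicThreePointStep.F ((cell w a b c y 0) + (cell w a b c y 1) + (cell w a b c y 3) + (cell w a b c y 5)) ((cell w a b c y 6) + (cell w a b c y 11) + (cell w a b c y 13)) ((cell w a b c y 4) + (cell w a b c y 8) + (cell w a b c y 10)) ((cell w a b c y 2) + (cell w a b c y 7) + (cell w a b c y 9)) ((cell w a b c y 12) + (cell w a b c y 14)) := by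
  have h := threePointLB_prodBernoulli w a b y
  rw [FourPointAtoms.real_xCabCay, FourPointAtoms.real_xDabDayDby, FourPointAtoms.real_xCabDay, FourPointAtoms.real_xCayDab, FourPointAtoms.real_xCbyDab] at h
  have hs : (cell w a b c y 0) + (cell w a b c y 1) + (cell w a b c y 3) + (cell w a b c y 5) + ((cell w a b c y 6) + (cell w a b c y 11) + (cell w a b c y 13)) + ((cell w a b c y 4) + (cell w a b c y 8) + (cell w a b c y 10)) + ((cell w a b c y 2) + (cell w a b c y 7) + (cell w a b c y 9)) + ((cell w a b c y 12) + (cell w a b c y 14)) + ((cell w a b c y 12) + (cell w a b c y 14)) = 1 + ((cell w a b c y 12) + (cell w a b c y 14)) := by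
    have h1 := sum_cell_eq_one w a b c y; linarith
  simp only [CubicThreePointStep.F]
  rw [hs]
  exact h.trans_eq (by ring)

/-- Row `H_b_a_cy_cy` at the cells of `prodBernoulli w` — hybrid 3PT-LB `HybridThreePointLB.sahiE3_hybrid_nonneg` (b;a;cy;cy). -/
theorem row_H_b_a_cy_cy : 0 ≤ E3h ((cell w a b c y 0) + (cell w a b c y 1) + (cell w a b c y 2) + (cell w a b c y 3) + (cell w a b c y 4) + (cell w a b c y 5) + (cell w a b c y 6) + (cell w a b c y 7) + (cell w a b c y 8) + (cell w a b c y 9) + (cell w a b c y 10) + (cell w a b c y 11) + (cell w a b c y 12) + (cell w a b c y 13) + (cell w a b c y 14)) ((cell w a b c y 0) + (cell w a b c y 1) + (cell w a b c y 2) + (cell w a b c y 3) + (cell w a b c y 4) + (cell w a b c y 5) + (cell w a b c y 7) + (cell w a b c y 8) + (cell w a b c y 9) + (cell w a b c y 10)) ((cell w a b c y 0) + (cell w a b c y 1) + (cell w a b c y 2) + (cell w a b c y 3) + (cell w a b c y 6) + (cell w a b c y 7) + (cell w a b c y 11)) ((cell w a b c y 0) + (cell w a b c y 1) + (cell w a b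 c y 4) + (cell w a b c y 5) + (cell w a b c y 6) + (cell w a b c y 10) + (cell w a b c y 11)) ((cell w a b c y 0) + (cell w a b c y 1) + (cell w a b c y 2) + (cell w a b c y 3) + (cell w a b c y 7)) ((cell w a b c y 0) + (cell w a b c y 1) + (cell w a b c y 4) + (cell w a b c y 5) + (cell w a b c y 10)) ((cell w a b c y 0) + (cell w a b c y 1) + (cell w a b c y 6) + (cell w a b c y 11)) ((cell w a b c y 0) + (cell w a b c y 1)) := by
  have h := HybridThreePointLB.sahiE3_hybrid_nonneg w a ({b} : Finset V) ({c, y} : Finset V) ({c, y} : Finset V) (Finset.Subset.refl _)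
  have e1 : {ω : BondConfig V | ∀ u ∈ ({b} : Finset V), ω ∉ openConn a u} = (openConn a b)ᶜ := by
    ext ω; simp only [Set.mem_setOf_eq, Set.mem_compl_iff, Finset.mem_singleton, forall_eq]
  have e2 : {ω : BondConfig V | ∀ v ∈ ({c, y} : Finset V), ω ∉ openConn a v} = (openConn a c)ᶜ ∩ (openConn a y)ᶜ := by
    ext ω; simp only [Set.mem_setOf_eq, Set.mem_inter_iff, Set.mem_compl_iff, Finset.mem_insert, Finset.mem_singleton, forall_eq_or_imp, forall_eq]
  have e3 : {ω : BondConfig V | ∀ v ∈ ({c, y} : Finset V), ∀ u ∈ ({b} : Finset V), ω ∉ openConn v u} = (openConn c b)ᶜ ∩ (openConn y b)ᶜ := by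
    ext ω; simp only [Set.mem_setOf_eq, Set.mem_inter_iff, Set.mem_compl_iff, Finset.mem_insert, Finset.mem_singleton, forall_eq_or_imp, forall_eq]
  rw [e1, e2, e3, sahiE3_def, FourPointAtoms.real_hyb2_C, rE0, FourPointAtoms.real_xDcbDyb, rE1, rE2, rE3, rE4] at h
  simp only [E3h]
  rw [sum_cell_eq_one w a b c y]
  exact h.trans_eq (by ring)

/-- Row `H_c_a_by_by` at the cells of `prodBernoulli w` — hybrid 3PT-LB `HybridThreePointLB.sahiE3_hybrid_nonneg` (c;a;by;by). -/
theorem row_H_c_a_by_by : 0 ≤ E3h ((cell w a b c y 0) + (cell w a b c y 1) + (cell w a b c y 2) + (cell w a b c y 3) + (cell w a b c y 4) + (cell w a b c y 5) + (cell w a b c y 6) + (cell w a b c y 7) + (cell w a b c y 8) + (cell w a b c y 9) + (cell w a b c y 10) + (cell w a b c y 11) + (cell w a b c y 12) + (cell w a b c y 13) + (cell w a b c y 14)) ((cell w a b c y 0) + (cell w a b c y 1) + (cell w a b c y 2) + (cell w a b c y 3) + (cell w a b c y 4) + (cell w a b c y 6) + (cell w a b c y 7) + (cell w a b c y 8) +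 (cell w a b c y 11) + (cell w a b c y 12)) ((cell w a b c y 0) + (cell w a b c y 1) + (cell w a b c y 2) + (cell w a b c y 3) + (cell w a b c y 5) + (cell w a b c y 7) + (cell w a b c y 9)) ((cell w a b c y 0) + (cell w a b c y 2) + (cell w a b c y 4) + (cell w a b c y 5) + (cell w a b c y 6) + (cell w a b c y 9) + (cell w a b c y 12)) ((cell w a b c y 0) + (cell w a b c y 1) + (cell w a b c y 2) + (cell w a b c y 3) + (cell w a b c y 7)) ((cell w a b c y 0) + (cell w a b c y 2) + (cell w a b c y 4) + (cell w a b c y 6) + (cell w a b c y 12)) ((cell w a b c y 0) + (cell w a b c y 2) + (cell w a b c y 5) + (cell w a b c y 9)) ((cell w a b c y 0) + (cell w a b c y 2)) := by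
  have h := HybridThreePointLB.sahiE3_hybrid_nonneg w a ({c} : Finset V) ({b, y} : Finset V) ({b, y} : Finset V) (Finset.Subset.refl _)
  have e1 : {ω : BondConfig V | ∀ u ∈ ({c} : Finset V), ω ∉ openConn a u} = (openConn a c)ᶜ := by
    ext ω; simp only [Set.mem_setOf_eq, Set.mem_compl_iff, Finset.mem_singleton, forall_eq]
  have e2 : {ω : BondConfig V | ∀ v ∈ ({b, y} : Finset V), ω ∉ openConn a v} = (openConn a b)ᶜ ∩ (openConn a y)ᶜ := by
    ext ω; simp only [Set.mem_setOf_eq, Set.mem_inter_iff, Set.mem_compl_iff, Finset.mem_insert, Finset.mem_singleton, forall_eq_or_imp, forall_eq]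
  have e3 : {ω : BondConfig V | ∀ v ∈ ({b, y} : Finset V), ∀ u ∈ ({c} : Finset V), ω ∉ openConn v u} = (openConn b c)ᶜ ∩ (openConn y c)ᶜ := by
    ext ω; simp only [Set.mem_setOf_eq, Set.mem_inter_iff, Set.mem_compl_iff, Finset.mem_insert, Finset.mem_singleton, forall_eq_or_imp, forall_eq]
  rw [e1, e2, e3, sahiE3_def, FourPointAtoms.real_hyb1_B, FourPointAtoms.real_xDabDay, FourPointAtoms.real_xDbcDyc, rE5, rE6, rE7, rE8] at h
  simp only [E3h]
  rw [sum_cell_eq_one w a b c y]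
  exact h.trans_eq (by ring)

omit [DecidableEq V] in
/-- Row `Fbcy` at the cells of `prodBernoulli w` — 3PT-LB `threePointLB_prodBernoulli`. -/
theorem row_Fbcy : 0 ≤ CubicThreePointStep.F ((cell w a b c y 0) + (cell w a b c y 4) + (cell w a b c y 5) + (cell w a b c y 6)) ((cell w a b c y 3) + (cell w a b c y 8) + (cell w a b c y 13)) ((cell w a b c y 2) + (cell w a b c y 9) + (cell w a b c y 12)) ((cell w a b c y 1) + (cell w a b c y 10) + (cell w a b c y 11)) ((cell w a b c y 7) + (cell w a b c y 14)) := by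
  have h := threePointLB_prodBernoulli w b c y
  rw [FourPointAtoms.real_xCbcCby, FourPointAtoms.real_xDbcDbyDcy, FourPointAtoms.real_xCbcDby, FourPointAtoms.real_xCbyDbc, FourPointAtoms.real_xCcyDbc] at h
  have hs : (cell w a b c y 0) + (cell w a b c y 4) + (cell w a b c y 5) + (cell w a b c y 6) + ((cell w a b c y 3) + (cell w a b c y 8) + (cell w a b c y 13)) + ((cell w a b c y 2) + (cell w a b c y 9) + (cell w a b c y 12)) + ((cell w a b c y 1) + (cell w a b c y 10) + (cell w a b c y 11)) + ((cell w a b c y 7) + (cell w a b c y 14)) + ((cell w a b c y 7) + (cell w a b c y 14)) = 1 + ((cell w a b c y 7) + (cell w a b c y 14)) := by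
    have h1 := sum_cell_eq_one w a b c y; linarith
  simp only [CubicThreePointStep.F]
  rw [hs]
  exact h.trans_eq (by ring)

/-- Row `H_y_b_a_ac` at the cells of `prodBernoulli w` — hybrid 3PT-LB `HybridThreePointLB.sahiE3_hybrid_nonneg` (y;b;a;ac). -/
theorem row_H_y_b_a_ac : 0 ≤ E3h ((cell w a b c y 0) + (cell w a b c y 1) + (cell w a b c y 2) + (cell w a b c y 3) + (cell w a b c y 4) + (cell w a b c y 5) + (cell w a b c y 6) + (cell w a b c y 7) + (cell w a b c y 8) + (cell w a b c y 9) + (cell w a b c y 10) + (cell w a b c y 11) + (cell w a b c y 12) + (cell w a b c y 13) + (cell w a b c y 14)) ((cell w a b c y 0) + (cell w a b c y 1) + (cell w a b c y 3) + (cell w a b c y 4) + (cell w a b c y 5) + (cell w a b c y 6) + (cell w a b c y 8) + (cell w a b c y 10) + (cell w a b c y 11) + (cell w a b c y 13)) ((cell w a b c y 0) + (cell w a b c y 1) + (cell w a b c y 2) + (cell w a b c y 3) + (cell w a b c y 4) + (cell w a b c y 5) + (cell w a b c y 7) + (cell w a b c y 8) + (cell w a b c y 9) + (cell w a b c y 10))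 ((cell w a b c y 0) + (cell w a b c y 2) + (cell w a b c y 3) + (cell w a b c y 5) + (cell w a b c y 6) + (cell w a b c y 9) + (cell w a b c y 13)) ((cell w a b c y 0) + (cell w a b c y 1) + (cell w a b c y 3) + (cell w a b c y 4) + (cell w a b c y 5) + (cell w a b c y 8) + (cell w a b c y 10)) ((cell w a b c y 0) + (cell w a b c y 3) + (cell w a b c y 5) + (cell w a b c y 6) + (cell w a b c y 13)) ((cell w a b c y 0) + (cell w a b c y 2) + (cell w a b c y 3) + (cell w a b c y 5) + (cell w a b c y 9)) ((cell w a b c y 0) + (cell w a b c y 3) + (cell w a b c y 5)) := by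
  have h := HybridThreePointLB.sahiE3_hybrid_nonneg w b ({y} : Finset V) ({a} : Finset V) ({a, c} : Finset V) (Finset.singleton_subset_iff.2 (by simp))
  have e1 : {ω : BondConfig V | ∀ u ∈ ({y} : Finset V), ω ∉ openConn b u} = (openConn b y)ᶜ := by
    ext ω; simp only [Set.mem_setOf_eq, Set.mem_compl_iff, Finset.mem_singleton, forall_eq]
  have e2 : {ω : BondConfig V | ∀ v ∈ ({a} : Finset V), ω ∉ openConn b v} = (openConn b a)ᶜ := by
    ext ω; simp only [Set.mem_setOf_eq, Set.mem_compl_iff, Finset.mem_singleton, forall_eq]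
  have e3 : {ω : BondConfig V | ∀ v ∈ ({a, c} : Finset V), ∀ u ∈ ({y} : Finset V), ω ∉ openConn v u} = (openConn a y)ᶜ ∩ (openConn c y)ᶜ := by
    ext ω; simp only [Set.mem_setOf_eq, Set.mem_inter_iff, Set.mem_compl_iff, Finset.mem_insert, Finset.mem_singleton, forall_eq_or_imp, forall_eq]
  rw [e1, e2, e3, sahiE3_def, FourPointAtoms.real_xDby, FourPointAtoms.real_xDba, FourPointAtoms.real_xDayDcy, FourPointAtoms.real_xDbyDbaIDayDcyJ, FourPointAtoms.real_xDbaIDayDcyJ, FourPointAtoms.real_xDbyIDayDcyJ, FourPointAtoms.real_xDbyDba] at h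
  simp only [E3h]
  rw [sum_cell_eq_one w a b c y]
  exact h.trans_eq (by ring)

/-- Row `H_y_b_ac_ac` at the cells of `prodBernoulli w` — hybrid 3PT-LB `HybridThreePointLB.sahiE3_hybrid_nonneg` (y;b;ac;ac). -/
theorem row_H_y_b_ac_ac : 0 ≤ E3h ((cell w a b c y 0) + (cell w a b c y 1) + (cell w a b c y 2) + (cell w a b c y 3) + (cell w a b c y 4) + (cell w a b c y 5) + (cell w a b c y 6) + (cell w a b c y 7) + (cell w a b c y 8) + (cell w a b c y 9) + (cell w a b c y 10) + (cell w a b c y 11) + (cell w a b c y 12) + (cell w a b c y 13) + (cell w a b c y 14)) ((cell w a b c y 0) + (cell w a b c y 1) + (cell w a b c y 3) + (cell w a b c y 4) + (cell w a b c y 5) + (cell w a b c y 6) + (cell w a b c y 8) + (cell w a b c y 10) + (cell w a b c y 11) + (cell w a b c y 13)) ((cell w a b c y 0) + (cell w a b c y 1) + (cell w a b c y 2) + (cell w a b c y 4) + (cell w a b c y 5) + (cell w a b c y 9) + (cell w a b c y 10)) ((cell w a b c y 0) + (cell w a b c y 2) + (cell w a b c y 3) + (cell w a b c y 5) + (cell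 w a b c y 6) + (cell w a b c y 9) + (cell w a b c y 13)) ((cell w a b c y 0) + (cell w a b c y 1) + (cell w a b c y 4) + (cell w a b c y 5) + (cell w a b c y 10)) ((cell w a b c y 0) + (cell w a b c y 3) + (cell w a b c y 5) + (cell w a b c y 6) + (cell w a b c y 13)) ((cell w a b c y 0) + (cell w a b c y 2) + (cell w a b c y 5) + (cell w a b c y 9)) ((cell w a b c y 0) + (cell w a b c y 5)) := by
  have h := HybridThreePointLB.sahiE3_hybrid_nonneg w b ({y} : Finset V) ({a, c} : Finset V) ({a, c} : Finset V) (Finset.Subset.refl _)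
  have e1 : {ω : BondConfig V | ∀ u ∈ ({y} : Finset V), ω ∉ openConn b u} = (openConn b y)ᶜ := by
    ext ω; simp only [Set.mem_setOf_eq, Set.mem_compl_iff, Finset.mem_singleton, forall_eq]
  have e2 : {ω : BondConfig V | ∀ v ∈ ({a, c} : Finset V), ω ∉ openConn b v} = (openConn b a)ᶜ ∩ (openConn b c)ᶜ := by
    ext ω; simp only [Set.mem_setOf_eq, Set.mem_inter_iff, Set.mem_compl_iff, Finset.mem_insert, Finset.mem_singleton, forall_eq_or_imp, forall_eq]
  have e3 : {ω : BondConfig V | ∀ v ∈ ({a, c} : Finset V), ∀ u ∈ ({y} : Finset V), ω ∉ openConn v u} = (openConn a y)ᶜ ∩ (openConn c y)ᶜ := by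
    ext ω; simp only [Set.mem_setOf_eq, Set.mem_inter_iff, Set.mem_compl_iff, Finset.mem_insert, Finset.mem_singleton, forall_eq_or_imp, forall_eq]
  rw [e1, e2, e3, sahiE3_def, FourPointAtoms.real_xDby, rE9, FourPointAtoms.real_xDayDcy, rE10, rE11, FourPointAtoms.real_xDbyIDayDcyJ, rE12] at h
  simp only [E3h]
  rw [sum_cell_eq_one w a b c y]
  exact h.trans_eq (by ring)

/-- Row `E1` at the cells of `prodBernoulli w` — hybrid 3PT-LB `HybridThreePointLB.sahiE3_hybrid_nonneg` (b;c;a;ay). -/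
theorem row_E1 : 0 ≤ hybE₁ (cell w a b c y 0) (cell w a b c y 1) (cell w a b c y 2) (cell w a b c y 3) (cell w a b c y 4) (cell w a b c y 5) (cell w a b c y 6) (cell w a b c y 7) (cell w a b c y 8) (cell w a b c y 9) (cell w a b c y 10) (cell w a b c y 11) (cell w a b c y 12) (cell w a b c y 13) (cell w a b c y 14) := by
  have h := HybridThreePointLB.sahiE3_hybrid_nonneg w c ({b} : Finset V) ({a} : Finset V) ({a, y} : Finset V) (Finset.singleton_subset_iff.2 (by simp))
  have e1 : {ω : BondConfig V | ∀ u ∈ ({b} : Finset V), ω ∉ openConn c u} = (openConn c b)ᶜ := by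
    ext ω; simp only [Set.mem_setOf_eq, Set.mem_compl_iff, Finset.mem_singleton, forall_eq]
  have e2 : {ω : BondConfig V | ∀ v ∈ ({a} : Finset V), ω ∉ openConn c v} = (openConn c a)ᶜ := by
    ext ω; simp only [Set.mem_setOf_eq, Set.mem_compl_iff, Finset.mem_singleton, forall_eq]
  have e3 : {ω : BondConfig V | ∀ v ∈ ({a, y} : Finset V), ∀ u ∈ ({b} : Finset V), ω ∉ openConn v u} = (openConn a b)ᶜ ∩ (openConn y b)ᶜ := by
    ext ω; simp only [Set.mem_setOf_eq, Set.mem_inter_iff, Set.mem_compl_iff, Finset.mem_insert, Finset.mem_singleton, forall_eq_or_imp, forall_eq]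
  rw [e1, e2, e3, sahiE3_def, FourPointAtoms.real_xDcb, FourPointAtoms.real_xDca, FourPointAtoms.real_grp_A, FourPointAtoms.real_xDcbDcaIDabDybJ, FourPointAtoms.real_xDcaIDabDybJ, FourPointAtoms.real_xDcbIDabDybJ, FourPointAtoms.real_xDcbDca] at h
  simp only [hybE₁, E3h]
  rw [sum_cell_eq_one w a b c y]
  exact h.trans_eq (by ring)

/-- Row `H_y_c_a_ab` at the cells of `prodBernoulli w` — hybrid 3PT-LB `HybridThreePointLB.sahiE3_hybrid_nonneg` (y;c;a;ab). -/
theorem row_H_y_c_a_ab : 0 ≤ E3h ((cell w a b c y 0) + (cell w a b c y 1) + (cell w a b c y 2) + (cell w a b c y 3) + (cell w a b c y 4) + (cell w a b c y 5) + (cell w a b c y 6) + (cell w a b c y 7) + (cell w a b c y 8) + (cell w a b c y 9) + (cell w a b c y 10) + (cell w a b c y 11) + (cell w a b c y 12) + (cell w a b c y 13) + (cell w a b c y 14)) ((cell w a b c y 0) + (cell w a b c y 2) + (cell w a b c y 3) + (cell w a b c y 4) + (cell w a b c y 5) + (cell w a b c y 6) + (cell w a b c y 8) + (cell w a b c y 9)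 + (cell w a b c y 12) + (cell w a b c y 13)) ((cell w a b c y 0) + (cell w a b c y 1) + (cell w a b c y 2) + (cell w a b c y 3) + (cell w a b c y 4) + (cell w a b c y 6) + (cell w a b c y 7) + (cell w a b c y 8) + (cell w a b c y 11) + (cell w a b c y 12)) ((cell w a b c y 0) + (cell w a b c y 1) + (cell w a b c y 3) + (cell w a b c y 5) + (cell w a b c y 6) + (cell w a b c y 11) + (cell w a b c y 13)) ((cell w a b c y 0) + (cell w a b c y 2) + (cell w a b c y 3) + (cell w a b c y 4) + (cell w a b c y 6) + (cell w a b c y 8) + (cell w a b c y 12)) ((cell w a b c y 0) + (cell w a b c y 3) + (cell w a b c y 5) + (cell w a b c y 6) + (cell w a b c y 13)) ((cell w a b c y 0) + (cell w a b c y 1) + (cell w a b c y 3) + (cell w a b c y 6) + (cell w a b c y 11)) ((cell w a b c y 0) + (cell w a b c y 3) + (cell w a b c y 6)) := by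
  have h := HybridThreePointLB.sahiE3_hybrid_nonneg w c ({y} : Finset V) ({a} : Finset V) ({a, b} : Finset V) (Finset.singleton_subset_iff.2 (by simp))
  have e1 : {ω : BondConfig V | ∀ u ∈ ({y} : Finset V), ω ∉ openConn c u} = (openConn c y)ᶜ := by
    ext ω; simp only [Set.mem_setOf_eq, Set.mem_compl_iff, Finset.mem_singleton, forall_eq]
  have e2 : {ω : BondConfig V | ∀ v ∈ ({a} : Finset V), ω ∉ openConn c v} = (openConn c a)ᶜ := by
    ext ω; simp only [Set.mem_setOf_eq, Set.mem_compl_iff, Finset.mem_singleton, forall_eq]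
  have e3 : {ω : BondConfig V | ∀ v ∈ ({a, b} : Finset V), ∀ u ∈ ({y} : Finset V), ω ∉ openConn v u} = (openConn a y)ᶜ ∩ (openConn b y)ᶜ := by
    ext ω; simp only [Set.mem_setOf_eq, Set.mem_inter_iff, Set.mem_compl_iff, Finset.mem_insert, Finset.mem_singleton, forall_eq_or_imp, forall_eq]
  rw [e1, e2, e3, sahiE3_def, FourPointAtoms.real_xDcy, FourPointAtoms.real_xDca, FourPointAtoms.real_xDayDby, FourPointAtoms.real_xDcyDcaIDayDbyJ, FourPointAtoms.real_xDcaIDayDbyJ, FourPointAtoms.real_xDcyIDayDbyJ, FourPointAtoms.real_xDcyDca] at h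
  simp only [E3h]
  rw [sum_cell_eq_one w a b c y]
  exact h.trans_eq (by ring)

/-- Row `Fe` at the cells of `prodBernoulli w` — 3PT-LB on the quotient `a = y` (weight `w[ay ↦ 1]`). -/
theorem row_Fe : 0 ≤ CubicThreePointStep.F ((cell w a b c y 0) + (cell w a b c y 4)) ((cell w a b c y 2) + (cell w a b c y 6) + (cell w a b c y 12)) ((cell w a b c y 1) + (cell w a b c y 5) + (cell w a b c y 10)) ((cell w a b c y 3) + (cell w a b c y 8)) ((cell w a b c y 7) + (cell w a b c y 9) + (cell w a b c y 11) + (cell w a b c y 13) + (cell w a b c y 14)) := by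
  have h := threePointLB_prodBernoulli (Function.update w s(a, y) 1) a b c
  simp only [real_update_ay w a y, Set.preimage_inter, Set.preimage_compl, preimage_insert_openConn a y] at h
  rw [rE13, rE14, rE15, rE16, rE17] at h
  have hs : (cell w a b c y 0) + (cell w a b c y 4) + ((cell w a b c y 2) + (cell w a b c y 6) + (cell w a b c y 12)) + ((cell w a b c y 1) + (cell w a b c y 5) + (cell w a b c y 10)) + ((cell w a b c y 3) + (cell w a b c y 8)) + ((cell w a b c y 7) + (cell w a b c y 9) + (cell w a b c y 11) + (cell w a b c y 13) + (cell w a b c y 14)) + ((cell w a b c y 7) + (cell w a b c y 9) + (cell w a b c y 11) + (cell w a b c y 13) + (cell w a b c y 14)) = 1 + ((cell w a b c y 7) + (cell w a b c y 9) + (cell w a b c y 11) + (cell w a b c y 13) + (cell w a b c y 14)) := by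
    have h1 := sum_cell_eq_one w a b c y; linarith
  simp only [CubicThreePointStep.F]
  rw [hs]
  exact h.trans_eq (by ring)

omit [DecidableEq V] in
/-- Row `AGabc` at the cells of `prodBernoulli w` — Aas–Gladkov `prodBernoulli_threePoint_strongHarris`. -/
theorem row_AGabc : 0 ≤ ((cell w a b c y 0) + (cell w a b c y 1) + (cell w a b c y 2) + (cell w a b c y 4)) * ((cell w a b c y 13) + (cell w a b c y 14)) - (((cell w a b c y 6) + (cell w a b c y 11) + (cell w a b c y 12)) * ((cell w a b c y 5) + (cell w a b c y 9) + (cell w a b c y 10)) + ((cell w a b c y 6) + (cell w a b c y 11) + (cell w a b c y 12)) * ((cell w a b c y 3) + (cell w a b c y 7) + (cell w a b c y 8)) + ((cell w a b c y 5) + (cell w a b c y 9) + (cell w a b c y 10)) * ((cell w a b c y 3) + (cell w a b c y 7) + (cell w a b c y 8))) := by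
  have h := prodBernoulli_threePoint_strongHarris w a b c
  rw [FourPointAtoms.real_lu1, FourPointAtoms.real_lu2, FourPointAtoms.real_lu3, FourPointAtoms.real_lt, FourPointAtoms.real_shk_ABC] at h
  exact (sub_nonneg.mpr h).trans_eq (by ring)

omit [DecidableEq V] in
/-- Row `AGaby` at the cells of `prodBernoulli w` — Aas–Gladkov `prodBernoulli_threePoint_strongHarris`. -/
theorem row_AGaby : 0 ≤ ((cell w a b c y 0) + (cell w a b c y 1) + (cell w a b c y 3) + (cell w a b c y 5)) * ((cell w a b c y 12) + (cell w a b c y 14)) - (((cell w a b c y 6) + (cell w a b c y 11) + (cell w a b c y 13)) * ((cell w a b c y 4) + (cell w a b c y 8) + (cell w a b c y 10)) + ((cell w a b c y 6) + (cell w a b c y 11) + (cell w a b c y 13)) * ((cell w a b c y 2) + (cell w a b c y 7) + (cell w a b c y 9)) + ((cell w a b c y 4) + (cell w a b c y 8) + (cell w a b c y 10)) * ((cell w a b c y 2) + (cell w a b c y 7) + (cell w a b c y 9))) := by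
  have h := prodBernoulli_threePoint_strongHarris w a b y
  rw [FourPointAtoms.real_xCabDay, FourPointAtoms.real_xCayDab, FourPointAtoms.real_xCbyDab, FourPointAtoms.real_xCabCay, FourPointAtoms.real_xDabDayDby] at h
  exact (sub_nonneg.mpr h).trans_eq (by ring)

omit [DecidableEq V] in
/-- Row `AGacy` at the cells of `prodBernoulli w` — Aas–Gladkov `prodBernoulli_threePoint_strongHarris`. -/
theorem row_AGacy : 0 ≤ ((cell w a b c y 0) + (cell w a b c y 2) + (cell w a b c y 3) + (cell w a b c y 6)) * ((cell w a b c y 10) + (cell w a b c y 14)) - (((cell w a b c y 5) + (cell w a b c y 9) + (cell w a b c y 13)) * ((cell w a b c y 4) + (cell w a b c y 8) + (cell w a b c y 12)) + ((cell w a b c y 5) + (cell w a b c y 9) + (cell w a b c y 13)) * ((cell w a b c y 1) + (cell w a b c y 7) + (cell w a b c y 11)) + ((cell w a b c y 4) + (cell w a b c y 8) + (cell w a b c y 12)) * ((cell w a b c y 1) + (cell w a b c y 7) + (cell w a b c y 11))) := by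
  have h := prodBernoulli_threePoint_strongHarris w a c y
  rw [FourPointAtoms.real_xCacDay, FourPointAtoms.real_xCayDac, FourPointAtoms.real_xCcyDac, FourPointAtoms.real_xCacCay, FourPointAtoms.real_xDacDayDcy] at h
  exact (sub_nonneg.mpr h).trans_eq (by ring)

omit [DecidableEq V] in
/-- Row `AGbcy` at the cells of `prodBernoulli w` — Aas–Gladkov `prodBernoulli_threePoint_strongHarris`. -/
theorem row_AGbcy : 0 ≤ ((cell w a b c y 0) + (cell w a b c y 4) + (cell w a b c y 5) + (cell w a b c y 6)) * ((cell w a b c y 7) + (cell w a b c y 14)) - (((cell w a b c y 3) + (cell w a b c y 8) + (cell w a b c y 13)) * ((cell w a b c y 2) + (cell w a b c y 9) + (cell w a b c y 12)) + ((cell w a b c y 3) + (cell w a b c y 8) + (cell w a b c y 13)) * ((cell w a b c y 1) + (cell w a b c y 10) + (cell w a b c y 11)) + ((cell w a b c y 2) + (cell w a b c y 9) + (cell w a b c y 12)) * ((cell w a b c y 1) + (cell w a b c y 10) + (cell w a b c y 11))) := by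
  have h := prodBernoulli_threePoint_strongHarris w b c y
  rw [FourPointAtoms.real_xCbcDby, FourPointAtoms.real_xCbyDbc, FourPointAtoms.real_xCcyDbc, FourPointAtoms.real_xCbcCby, FourPointAtoms.real_xDbcDbyDcy] at h
  exact (sub_nonneg.mpr h).trans_eq (by ring)

/-- Row `AGe` at the cells of `prodBernoulli w` — Aas–Gladkov on the quotient `a = y` (weight `w[ay ↦ 1]`, `BHK2006.prodBernoulli_map_union`). -/
theorem row_AGe : 0 ≤ ((cell w a b c y 0) + (cell w a b c y 4)) * ((cell w a b c y 7) + (cell w a b c y 9) + (cell w a b c y 11) + (cell w a b c y 13) + (cell w a b c y 14)) - (((cell w a b c y 2) + (cell w a b c y 6) + (cell w a b c y 12)) * ((cell w a b c y 1) + (cell w a b c y 5) + (cell w a b c y 10)) + ((cell w a b c y 2) + (cell w a b c y 6) + (cell w a b c y 12)) * ((cell w a b c y 3) + (cell w a b c y 8)) + ((cell w a b c y 1) + (cell w a b c y 5) + (cell w a b c y 10)) * ((cell w a b c y 3) + (cell w a b c y 8))) := by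
  have h := prodBernoulli_threePoint_strongHarris (Function.update w s(a, y) 1) a b c
  simp only [real_update_ay w a y, Set.preimage_inter, Set.preimage_compl, preimage_insert_openConn a y] at h
  rw [rE15, rE16, rE17, rE13, rE14] at h
  exact (sub_nonneg.mpr h).trans_eq (by ring)

omit [DecidableEq V] in
/-- Row `Facy` at the cells of `prodBernoulli w` — 3PT-LB `threePointLB_prodBernoulli`. -/
theorem row_Facy : 0 ≤ CubicThreePointStep.F ((cell w a b c y 0) + (cell w a b c y 2) + (cell w a b c y 3) + (cell w a b c y 6)) ((cell w a b c y 5) + (cell w a b c y 9) + (cell w a b c y 13)) ((cell w a b c y 4) + (cell w a b c y 8) + (cell w a b c y 12)) ((cell w a b c y 1) + (cell w a b c y 7) + (cell w a b c y 11)) ((cell w a b c y 10) + (cell w a b c y 14)) := by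
  have h := threePointLB_prodBernoulli w a c y
  rw [FourPointAtoms.real_xCacCay, FourPointAtoms.real_xDacDayDcy, FourPointAtoms.real_xCacDay, FourPointAtoms.real_xCayDac, FourPointAtoms.real_xCcyDac] at h
  have hs : (cell w a b c y 0) + (cell w a b c y 2) + (cell w a b c y 3) + (cell w a b c y 6) + ((cell w a b c y 5) + (cell w a b c y 9) + (cell w a b c y 13)) + ((cell w a b c y 4) + (cell w a b c y 8) + (cell w a b c y 12)) + ((cell w a b c y 1) + (cell w a b c y 7) + (cell w a b c y 11)) + ((cell w a b c y 10) + (cell w a b c y 14)) + ((cell w a b c y 10) + (cell w a b c y 14)) = 1 + ((cell w a b c y 10) + (cell w a b c y 14)) := by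
    have h1 := sum_cell_eq_one w a b c y; linarith
  simp only [CubicThreePointStep.F]
  rw [hs]
  exact h.trans_eq (by ring)

/-- Row `H_y_c_ab_ab` at the cells of `prodBernoulli w` — hybrid 3PT-LB `HybridThreePointLB.sahiE3_hybrid_nonneg` (y;c;ab;ab). -/
theorem row_H_y_c_ab_ab : 0 ≤ E3h ((cell w a b c y 0) + (cell w a b c y 1) + (cell w a b c y 2) + (cell w a b c y 3) + (cell w a b c y 4) + (cell w a b c y 5) + (cell w a b c y 6) + (cell w a b c y 7) + (cell w a b c y 8) + (cell w a b c y 9) + (cell w a b c y 10) + (cell w a b c y 11) + (cell w a b c y 12) + (cell w a b c y 13) + (cell w a b c y 14)) ((cell w a b c y 0) + (cell w a b c y 2) + (cell w a b c y 3) + (cell w a b c y 4) + (cell w a b c y 5) + (cell w a b c y 6) + (cell w a b c y 8) + (cell w a b c y 9) + (cell w a b c y 12) + (cell w a b c y 13)) ((cell w a b c y 0) + (cell w a b c y 1) + (cell w a b c y 2) + (cell w a b c y 4) + (cell w a b c y 6) + (cell w a b c y 11) + (cell w a b c y 12)) ((cell w a b c y 0) + (cell w a b c y 1) + (cell w a b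 c y 3) + (cell w a b c y 5) + (cell w a b c y 6) + (cell w a b c y 11) + (cell w a b c y 13)) ((cell w a b c y 0) + (cell w a b c y 2) + (cell w a b c y 4) + (cell w a b c y 6) + (cell w a b c y 12)) ((cell w a b c y 0) + (cell w a b c y 3) + (cell w a b c y 5) + (cell w a b c y 6) + (cell w a b c y 13)) ((cell w a b c y 0) + (cell w a b c y 1) + (cell w a b c y 6) + (cell w a b c y 11)) ((cell w a b c y 0) + (cell w a b c y 6)) := by
  have h := HybridThreePointLB.sahiE3_hybrid_nonneg w c ({y} : Finset V) ({a, b} : Finset V) ({a, b} : Finset V) (Finset.Subset.refl _)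
  have e1 : {ω : BondConfig V | ∀ u ∈ ({y} : Finset V), ω ∉ openConn c u} = (openConn c y)ᶜ := by
    ext ω; simp only [Set.mem_setOf_eq, Set.mem_compl_iff, Finset.mem_singleton, forall_eq]
  have e2 : {ω : BondConfig V | ∀ v ∈ ({a, b} : Finset V), ω ∉ openConn c v} = (openConn c a)ᶜ ∩ (openConn c b)ᶜ := by
    ext ω; simp only [Set.mem_setOf_eq, Set.mem_inter_iff, Set.mem_compl_iff, Finset.mem_insert, Finset.mem_singleton, forall_eq_or_imp, forall_eq]
  have e3 : {ω : BondConfig V | ∀ v ∈ ({a, b} : Finset V), ∀ u ∈ ({y} : Finset V), ω ∉ openConn v u} = (openConn a y)ᶜ ∩ (openConn b y)ᶜ := by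
    ext ω; simp only [Set.mem_setOf_eq, Set.mem_inter_iff, Set.mem_compl_iff, Finset.mem_insert, Finset.mem_singleton, forall_eq_or_imp, forall_eq]
  rw [e1, e2, e3, sahiE3_def, FourPointAtoms.real_xDcy, rE18, FourPointAtoms.real_xDayDby, rE19, rE20, FourPointAtoms.real_xDcyIDayDbyJ, rE21] at h
  simp only [E3h]
  rw [sum_cell_eq_one w a b c y]
  exact h.trans_eq (by ring)

/-- Row `E2` at the cells of `prodBernoulli w` — hybrid 3PT-LB `HybridThreePointLB.sahiE3_hybrid_nonneg` (c;b;a;ay). -/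
theorem row_E2 : 0 ≤ hybE₂ (cell w a b c y 0) (cell w a b c y 1) (cell w a b c y 2) (cell w a b c y 3) (cell w a b c y 4) (cell w a b c y 5) (cell w a b c y 6) (cell w a b c y 7) (cell w a b c y 8) (cell w a b c y 9) (cell w a b c y 10) (cell w a b c y 11) (cell w a b c y 12) (cell w a b c y 13) (cell w a b c y 14) := by
  have h := HybridThreePointLB.sahiE3_hybrid_nonneg w b ({c} : Finset V) ({a} : Finset V) ({a, y} : Finset V) (Finset.singleton_subset_iff.2 (by simp))
  have e1 : {ω : BondConfig V | ∀ u ∈ ({c} : Finset V), ω ∉ openConn b u} = (openConn b c)ᶜ := by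
    ext ω; simp only [Set.mem_setOf_eq, Set.mem_compl_iff, Finset.mem_singleton, forall_eq]
  have e2 : {ω : BondConfig V | ∀ v ∈ ({a} : Finset V), ω ∉ openConn b v} = (openConn b a)ᶜ := by
    ext ω; simp only [Set.mem_setOf_eq, Set.mem_compl_iff, Finset.mem_singleton, forall_eq]
  have e3 : {ω : BondConfig V | ∀ v ∈ ({a, y} : Finset V), ∀ u ∈ ({c} : Finset V), ω ∉ openConn v u} = (openConn a c)ᶜ ∩ (openConn y c)ᶜ := by
    ext ω; simp only [Set.mem_setOf_eq, Set.mem_inter_iff, Set.mem_compl_iff, Finset.mem_insert, Finset.mem_singleton, forall_eq_or_imp, forall_eq]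
  rw [e1, e2, e3, sahiE3_def, FourPointAtoms.real_hyb1_A, FourPointAtoms.real_xDba, FourPointAtoms.real_grp_B, rE22, rE23, FourPointAtoms.real_r2_AB, rE24] at h
  simp only [hybE₂, E3h]
  rw [sum_cell_eq_one w a b c y]
  exact h.trans_eq (by ring)

/-! ### Assembly -/

/-- **`polL₁ ≥ 0` at the four-point cells of every finite weighted graph** — the certificate `polL₁_nonneg_of_rows` with every row discharged. [this work] -/
theorem polL₁_cells_nonneg :
    0 ≤ polL₁ (cell w a b c y 0) (cell w a b c y 1) (cell w a b c y 2) (cell w a b c y 3) (cell w a b c y 4) (cell w a b c y 5) (cell w a b c y 6) (cell w a b c y 7) (cell w a b c y 8) (cell w a b c y 9) (cell w a b c y 10) (cell w a b c y 11) (cell w a b c y 12) (cell w a b c y 13) (cell w a b c y 14) :=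
  polL₁_nonneg_of_rows (cell_nonneg w a b c y 0) (cell_nonneg w a b c y 1) (cell_nonneg w a b c y 2) (cell_nonneg w a b c y 3) (cell_nonneg w a b c y 4) (cell_nonneg w a b c y 5) (cell_nonneg w a b c y 6) (cell_nonneg w a b c y 7) (cell_nonneg w a b c y 8) (cell_nonneg w a b c y 9) (cell_nonneg w a b c y 10) (cell_nonneg w a b c y 11) (cell_nonneg w a b c y 12) (cell_nonneg w a b c y 13) (cell_nonneg w a b c y 14)
    (row_Fabc w a b c y) (row_Faby w a b c y) (row_H_b_a_cy_cy w a b c y) (row_H_c_a_by_by w a b c y) (row_Fbcy w a b c y) (TerminalEdgeStep.hybE₃g_cell_nonneg w a b c y) (row_H_y_b_a_ac w a b c y) (row_H_y_b_ac_ac w a b c y) (row_E1 w a b c y) (row_H_y_c_a_ab w a b c y) (row_Fe w a b c y) (row_AGabc w a b c y) (row_AGaby w a b c y) (row_AGacy w a b c y) (row_AGbcy w a b c y) (row_AGe w a b c y) (row_Facy w a b c y) (row_H_y_c_ab_ab w a b c y) (row_E2 w a b c y)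

/-- **THEOREM (L1) = `PolarisedRowL1` on every finite weighted graph**: `μ(a|bcy)·μ(b ↮ c) ≤ E₃(D_bc, D_ac, D[ay|b]) + E₃(D_bc, D[ay|c], D_ab)`
for `μ = prodBernoulli w`, all `a b c y` — the polarised first Bernstein piece of the SHK3⁺ terminal-edge step (harness-2 / prim-l12), hitherto
`@[conjecture]`.  Proof: prim-l12-p6's exact degree-5 certificate over theorem rows (kernel-replayed in `…CubicFourPointL1ThmCert`), the rows being
Aas–Gladkov ×5, 3PT-LB ×5 and the hybrid 3PT-LB ×9 (two of the nineteen on the quotient `a = y`). [this work] -/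
theorem polarisedRowL1 : PolarisedRowL1 := by
  intro V _ w a b c y
  classical
  have h := polL₁_cells_nonneg w a b c y
  rw [TerminalEdgeStep.polL₁_cell_eq] at h
  exact sub_nonneg.mp h

/-- **(L2) = `PolarisedRowL2`** on every finite weighted graph (from (L1), `TerminalEdgeStep.polarisedRowL2_of_polarisedRowL1`). [this work] -/
theorem polarisedRowL2 : PolarisedRowL2 := TerminalEdgeStep.polarisedRowL2_of_polarisedRowL1 polarisedRowL1

/-- **The Bernstein pieces (B1), (B2) of the SHK3⁺ terminal-edge step are nonnegative on every finite weighted graph**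
(prim-l12-p1's `BernsteinPieceB1/B2`, via `TerminalEdgeStep.bernsteinPieces_of_polarisedRowL1`). [this work] -/
theorem bernsteinPieces : BernsteinPieceB1 ∧ BernsteinPieceB2 := TerminalEdgeStep.bernsteinPieces_of_polarisedRowL1 polarisedRowL1

/-- The Bernstein terminal-edge step for every number of vertices (`TerminalEdgeStep.bernsteinStepUpTo_of_polarisedRowL1`). [this work] -/
theorem bernsteinStepUpTo (N₀ : ℕ) : TerminalEdgeStep.BernsteinStepUpTo N₀ :=
  TerminalEdgeStep.bernsteinStepUpTo_of_polarisedRowL1 polarisedRowL1 N₀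

/-- The polarised terminal-edge step for every number of vertices (`TerminalEdgeStep.polarisedStepUpTo_of_polarisedRowL1`). [this work] -/
theorem polarisedStepUpTo (N₀ : ℕ) : TerminalEdgeStep.PolarisedStepUpTo N₀ :=
  TerminalEdgeStep.polarisedStepUpTo_of_polarisedRowL1 polarisedRowL1 N₀

end L1ThmCert

end Summit.CriticalPhenomena.PercolationContinuityZ3.Theorems
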